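import Mathlib.Analysis.SpecialFunctions.SmoothTransition
import Mathlib.Analysis.Calculus.ContDiff.Bounds
import Mathlib.Analysis.Normed.Operator.Prod
import HarnessLib

/-!
# The smooth time cutoff of the local smoothing theory, with all-order derivative bounds

Analysis/FluidPDE support file on the discharge path of the named fact
`Literature.Analysis.FluidPDE.knss2009_local_smoothing` (`NSBoundedMildSmoothing.lean`;
Koch–Nadirashvili–Seregin–Šverák, Acta Math. 203 (2009) = arXiv:0709.3599, §4 p. 8, Prop. 4.1).
To differentiate the Duhamel term `B(v,w)(θ) = ∫₀^θ N_{θ-τ}[v(τ), w(τ)] dτ` in `(θ, ξ)` jointly at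
unit parabolic scale one splits the time integral with a **smooth cutoff** `χ(τ)`, `χ = 0` for
`τ ≤ 1/4`, `χ = 1` for `τ ≥ 1/2`: on the support of `1 - χ²` the kernel `K(θ - τ, ·)` is smooth
(`θ - τ ≥ 1/4`) and carries the derivatives, while on the support of `χ²` the fields are smooth and
carry them (after the substitution `q ↦ p - q`); both pieces have fixed domains of integration.
This file provides the cutoff `duhamelCutoff τ = Real.smoothTransition (4τ - 1)` and what the Leibniz
estimates of the near part consume: **global bounds of every order for the derivatives of a smooth
function which is constant outside a compact interval** (`exists_norm_iteratedFDeriv_le_of_eqOn`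
flavour for `smoothTransition`, `exists_norm_iteratedFDeriv_smoothTransition_le`), transported to the
lifted cutoff `(τ, ξ) ↦ χ(τ)` on `ℝ × E` (`exists_norm_iteratedFDeriv_duhamelCutoff_fst_le`, composition
with the affine map `(τ, ξ) ↦ 4τ - 1` of norm `4`).

## References

* G. Koch, N. Nadirashvili, G. Seregin, V. Šverák, Acta Math. 203 (2009) = arXiv:0709.3599,
  §4 p. 8, Prop. 4.1 (the splitting of `B` behind "the key is an estimate of `B` … in the norms
  (4.5)"). [KochNadirashviliSereginSverak2009]
-/

noncomputable section

open Set Function Filter Metric Real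
open scoped Topology ContDiff

namespace Literature.Analysis.FluidPDE

/-! ### Global derivative bounds for `Real.smoothTransition` -/

section SmoothTransition

/-- **All derivatives of `Real.smoothTransition` are bounded on `ℝ`**: the function is `C^∞`,
vanishes on `(-∞, 0]` and equals `1` on `[1, ∞)`, so every iterated derivative is continuous and
vanishes off `[0, 1]` except the function itself, which is bounded by `1`. [folklore] -/
theorem exists_norm_iteratedFDeriv_smoothTransition_le (i : ℕ) :
    ∃ c : ℝ, 0 ≤ c ∧ ∀ x : ℝ, ‖iteratedFDeriv ℝ i Real.smoothTransition x‖ ≤ c := by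
  have hsm : ContDiff ℝ ∞ Real.smoothTransition := Real.smoothTransition.contDiff
  have hcont : Continuous (iteratedFDeriv ℝ i Real.smoothTransition) :=
    hsm.continuous_iteratedFDeriv (by exact_mod_cast le_top)
  obtain ⟨c, hc⟩ := (isCompact_Icc (a := (0 : ℝ)) (b := 1)).exists_bound_of_continuousOn
    hcont.continuousOn
  refine ⟨max c 1, le_max_of_le_right zero_le_one, fun x => ?_⟩
  by_cases hx : x ∈ Icc (0 : ℝ) 1
  · exact (hc x hx).trans (le_max_left _ _)
  · -- off `[0, 1]` the function is locally constant
    rw [mem_Icc, not_and_or, not_le, not_le] at hx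
    rcases hx with hx | hx
    · have hev : Real.smoothTransition =ᶠ[𝓝 x] fun _ => (0 : ℝ) := by
        filter_upwards [Iio_mem_nhds hx] with y hy
        exact Real.smoothTransition.zero_of_nonpos hy.le
      rw [(hev.iteratedFDeriv ℝ i).eq_of_nhds]
      rcases Nat.eq_zero_or_pos i with rfl | hi
      · simp
      · rw [iteratedFDeriv_const_of_ne hi.ne']
        simp
    · have hev : Real.smoothTransition =ᶠ[𝓝 x] fun _ => (1 : ℝ) := by
        filter_upwards [Ioi_mem_nhds hx] with y hy
        exact Real.smoothTransition.one_of_one_le hy.le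
      rw [(hev.iteratedFDeriv ℝ i).eq_of_nhds]
      rcases Nat.eq_zero_or_pos i with rfl | hi
      · simp
      · rw [iteratedFDeriv_const_of_ne hi.ne']
        simp

end SmoothTransition

/-! ### The cutoff -/

section Cutoff

/-- **The smooth time cutoff** `χ(τ) = smoothTransition (4τ - 1)`: `C^∞`, `0 ≤ χ ≤ 1`, `χ = 0` on
`(-∞, 1/4]`, `χ = 1` on `[1/2, ∞)`. [folklore] -/
def duhamelCutoff (τ : ℝ) : ℝ :=
  Real.smoothTransition (4 * τ - 1)

/-- `χ(τ) = 0` for `τ ≤ 1/4`. [folklore] -/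
theorem duhamelCutoff_of_le {τ : ℝ} (h : τ ≤ 1 / 4) : duhamelCutoff τ = 0 :=
  Real.smoothTransition.zero_of_nonpos (by rw [sub_nonpos]; linarith)

/-- `χ(τ) = 1` for `1/2 ≤ τ`. [folklore] -/
theorem duhamelCutoff_of_ge {τ : ℝ} (h : 1 / 2 ≤ τ) : duhamelCutoff τ = 1 :=
  Real.smoothTransition.one_of_one_le (by linarith)

/-- `0 ≤ χ`. [folklore] -/
theorem duhamelCutoff_nonneg (τ : ℝ) : 0 ≤ duhamelCutoff τ :=
  Real.smoothTransition.nonneg _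

/-- `χ ≤ 1`. [folklore] -/
theorem duhamelCutoff_le_one (τ : ℝ) : duhamelCutoff τ ≤ 1 :=
  Real.smoothTransition.le_one _

/-- `0 ≤ 1 - χ² ≤ 1`, first half. [folklore] -/
theorem one_sub_duhamelCutoff_sq_nonneg (τ : ℝ) : 0 ≤ 1 - duhamelCutoff τ ^ 2 := by
  have h0 := duhamelCutoff_nonneg τ
  have h1 := duhamelCutoff_le_one τ
  nlinarith

/-- `0 ≤ 1 - χ² ≤ 1`, second half. [folklore] -/
theorem one_sub_duhamelCutoff_sq_le_one (τ : ℝ) : 1 - duhamelCutoff τ ^ 2 ≤ 1 := by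
  nlinarith [sq_nonneg (duhamelCutoff τ)]

/-- `|1 - χ²| ≤ 1`. [folklore] -/
theorem abs_one_sub_duhamelCutoff_sq_le_one (τ : ℝ) : |1 - duhamelCutoff τ ^ 2| ≤ 1 := by
  rw [abs_of_nonneg (one_sub_duhamelCutoff_sq_nonneg τ)]
  exact one_sub_duhamelCutoff_sq_le_one τ

/-- The cutoff is `C^∞`. [folklore] -/
theorem contDiff_duhamelCutoff {n : ℕ∞} : ContDiff ℝ n duhamelCutoff :=
  Real.smoothTransition.contDiff.comp ((contDiff_const.mul contDiff_id).sub contDiff_const)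

/-- The cutoff is continuous. [folklore] -/
theorem continuous_duhamelCutoff : Continuous duhamelCutoff :=
  (contDiff_duhamelCutoff (n := 0)).continuous

end Cutoff

/-! ### The lifted cutoff `(τ, ξ) ↦ χ(τ)` on `ℝ × E` -/

section Lift

variable {E : Type*} [NormedAddCommGroup E] [NormedSpace ℝ E]

/-- The lifted cutoff is `C^∞` on `ℝ × E`. [folklore] -/
theorem contDiff_duhamelCutoff_fst {n : ℕ∞} : ContDiff ℝ n fun r : ℝ × E => duhamelCutoff r.1 :=
  contDiff_duhamelCutoff.comp contDiff_fst

/-- The lifted cutoff as `smoothTransition` composed with the affine map `r ↦ 4 r.1 - 1`: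
`χ(r.1) = (smoothTransition ∘ (· + (-1))) (ℓ r)`, `ℓ = 4 • fst`. [folklore] -/
theorem duhamelCutoff_fst_eq_comp (r : ℝ × E) :
    duhamelCutoff r.1 =
      ((fun y : ℝ => Real.smoothTransition (y + (-1))) ∘
        ((4 : ℝ) • ContinuousLinearMap.fst ℝ ℝ E)) r := by
  simp [duhamelCutoff, sub_eq_add_neg]

/-- **All derivatives of the lifted cutoff are bounded on `ℝ × E`**: for every `i` there is
`c ≥ 0` with `‖D^i [(τ, ξ) ↦ χ(τ)] (r)‖ ≤ c` for all `r` (the bound for `smoothTransition` times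
`‖4 • fst‖^i ≤ 4^i`). [folklore] -/
theorem exists_norm_iteratedFDeriv_duhamelCutoff_fst_le (i : ℕ) :
    ∃ c : ℝ, 0 ≤ c ∧ ∀ r : ℝ × E, ‖iteratedFDeriv ℝ i (fun r : ℝ × E => duhamelCutoff r.1) r‖ ≤ c := by
  obtain ⟨c, hc0, hc⟩ := exists_norm_iteratedFDeriv_smoothTransition_le i
  refine ⟨c * 4 ^ i, by positivity, fun r => ?_⟩
  set ℓ : (ℝ × E) →L[ℝ] ℝ := (4 : ℝ) • ContinuousLinearMap.fst ℝ ℝ E with hℓ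
  set g : ℝ → ℝ := fun y => Real.smoothTransition (y + (-1)) with hg
  have hgs : ContDiff ℝ ∞ g := Real.smoothTransition.contDiff.comp (contDiff_id.add contDiff_const)
  have hfun : (fun r : ℝ × E => duhamelCutoff r.1) = g ∘ ℓ := funext fun r => duhamelCutoff_fst_eq_comp r
  rw [hfun, ℓ.iteratedFDeriv_comp_right hgs r (i := i) (by exact_mod_cast le_top)]
  refine (ContinuousMultilinearMap.norm_compContinuousLinearMap_le _ _).trans ?_
  rw [Finset.prod_const, Finset.card_univ, Fintype.card_fin]
  have h1 : ‖iteratedFDeriv ℝ i g (ℓ r)‖ ≤ c := by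
    rw [hg, iteratedFDeriv_comp_add_right]
    exact hc _
  have h2 : ‖ℓ‖ ≤ 4 := by
    rw [hℓ]
    refine (norm_smul_le (4 : ℝ) (ContinuousLinearMap.fst ℝ ℝ E)).trans ?_
    have : ‖ContinuousLinearMap.fst ℝ ℝ E‖ ≤ 1 := ContinuousLinearMap.norm_fst_le (𝕜 := ℝ) (E := ℝ) (F := E)
    calc ‖(4 : ℝ)‖ * ‖ContinuousLinearMap.fst ℝ ℝ E‖ ≤ 4 * 1 := by
          rw [Real.norm_of_nonneg (by norm_num : (0 : ℝ) ≤ 4)]; gcongr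
      _ = 4 := by norm_num
  exact mul_le_mul h1 (pow_le_pow_left₀ (norm_nonneg _) h2 i) (by positivity) hc0

end Lift

end Literature.Analysis.FluidPDE

end
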